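import Summits.BirchSwinnertonDyer.Rank1Residual.F1Sign2.IntegralKuriharaPairAtTwo
import Summits.BirchSwinnertonDyer.Rank1Residual.F1Sign2.SupersingularTowerNormIndexAtTwo
import Summits.BirchSwinnertonDyer.Rank1Residual.F1Sign2.TwistByTwoOfUnitAtTwo
import Mathlib.RingTheory.Polynomial.Resultant.Basic
import Mathlib.NumberTheory.Padics.PadicNumbers
import HarnessLib.Audit.Tags
import HarnessLib

/-!
# Cell `bsd-f1-sign2`, IMC lens (planner-of-record `-imc` g14, MEMO-imc §10.93 / D-imc-50): the Kurihara pair LEVEL SEQUENCE at `p = 2` —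
# P50a `KuriharaPairTorsionRecursion`, P50b `MazurTateLevelNormValuationRecursionAtTwo`, P50c′ `MazurTateLevelNormJacobsthalLawAtTwoR` (REF1-certified
# THEOREM-GRADE algebra targets, plain `def`s), P50d/P50e/P50f (`@[conjecture]`); sibling of `F1Sign2/IntegralKuriharaPairAtTwo.lean` (g13, p672838)

PORT (cell `bsd-f1-sign2`, seat `-ty` g13; TURNKEY D-imc-50, INBOX 2026-08-28T22:40:47Z, REF1-gated → filed after REF1 §147) of -imc g14's
`HOME/MEMO-imc-data/dimc50/lean/SketchG14KPI.lean` — the SIX-PROP file of record `SketchG14KPI.v1b-six-props.lean` 1324fe3e8f721f29 audited by REF1 §147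
(the current v2 file 5ae2e4516bd634b6 = v1b + §10.93-add1 P50g `KuriharaOtsukiCyclicUpperBoundAtTwo` + carrier `kuriharaPairModTwoPowCard`; the six shared bodies
are byte-identical — checked by the typer's diff).  MEMO-imc §10.93 (memo 42a59b065cf7f5bd l.1683; bundle `MEMO-imc-data/dimc50/` README-50 ff648e5147c210…,
BC7 probe `ProbeG14KPI.out` 7/7 CLEAN).  Bodies VERBATIM from the sketch, in the sketch's order; typer edits: this header, `import HarnessLib.Audit.Tags`,
**P50a/P50b filed as PLAIN `def`s** (REF1 §147: THEOREM-GRADE, words-proofs (A)/(B) certified step by step — director ruling v4.0-add1 frontier-ledger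
words-theorems; the sketch had `@[conjecture]`), **P50c `MazurTateLevelNormJacobsthalLawAtTwo` NOT FILED — KILLED AS TYPED by REF1 §147 (refuted-misstated:
clause (iii) typed for every even `a` but the proof sets `a = 0`; witness `a = 2, d = 1, c = 2`, `v₂N₅ = 15 ≠ 13`) — REPLACED by REF1's REPAIR P50c′
`MazurTateLevelNormJacobsthalLawAtTwoR`** (clause (iii) under `a = 0 →`; typed VERBATIM from REF1 `Probe147.lean` de756897465eecb2; (i)(ii) theorem-grade for
every even `a`; plain `def`), P50d/P50e/P50f keep `@[conjecture]`, REF1/REF2 riders in the docstrings — **P50f REFUTED AS TYPED by -imc's census 2026-08-28T23:39Z (5 witnesses,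
see its docstring; recorded negative, superseded by v3's P50f′/P50f″ pending REF1)**.  APPENDED (pass 2, -ty g13, after REF1 §148 = D-imc-50-R1
ADDENDUM): P50g `KuriharaOtsukiCyclicUpperBoundAtTwo` (`@[conjecture]`, v2 body VERBATIM) + carrier `kuriharaPairModTwoPowCard` + REF1 rider R-148-i twin
`KuriharaOtsukiCyclicUpperBoundAtTwoNonCM` (`¬ W.HasCM`) with kernel glue — see the APPEND section at the end.  Helper `MTThreeTermAt` is an untagged `def … : Prop` with
parameters (a definition, not a named fact); sanity theorems `koMinimalClassVal_values` / `koMinimalClassExponent_values` by `decide` (LIST form) verbatim.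
REF1 §147 = D-imc-50-R1 (refuter-bsd-f1-sign2-ref1 g13, `HOME/REF1-AUDIT-v1.md` §147; evidence `HOME/REF1-data/b147/` — `lean/Probe147.lean` de756897465eecb2 farm
rc 0, `engine147.py` exact pure-Python engine + outputs; INBOX 2026-08-28T22:53:23Z) ONE LINE verbatim: «§147 STAMP D-imc-50-R1 … P50a SURVIVES THEOREM-GRADE
(words-proof (A) certified step by step incl. Ann_{R_n}(ν_n) = ω_{n−1}R_n, ker ψ_n = (ν_n), Z_n = Z_{n−1}, index 2^r; engine 18/18 incl. ODD a and generic
lower levels). P50b SURVIVES THEOREM-GRADE (certified; binder `(θ (n-2)).natDegree < 2^(n-2)` IDLE — 158/158 + 8/8 with it violated; `Even a`, `lam < 2^(n-2)`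
load-bearing). P50c (iii) KILLED AS TYPED — refuted-misstated … REPAIR P50c′ = `MazurTateLevelNormJacobsthalLawAtTwoR` (typed in Probe147: clause (iii) under
`a = 0 →`; kernel P50c → P50c′; witness misses it); (i)(ii) THEOREM-GRADE for every even a (180/180, 80/80). Arithmetic untouched (v₂c = 1 ⟺ a₂ = 0). P50d
SURVIVES conjecture-grade, bricks (D2)–(D6) CERTIFIED one by one … inputs that are NOT print/tree-theorems: (U) at a₂ = 0, L14-loc (tree CANDIDATE row),
D-imc-47 (B4)(ii); remark R-147-i: P50d has no analytic-rank binder on the twist, so it contains «corank Sel_{2^∞}(E^{(2)}/ℚ) = 1 for every class-(α) basic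
curve» (consistent with ES-C-D, 0 SKIPRANK/771). P50e SURVIVES: a₂ = ±2 in-print assembly CERTIFIED brick by brick, a₂ = 0 conjecture; one typed row covers
both ⇒ conjecture-class (a `frobeniusTrace 2 ≠ 0` twin would be theorem-grade). P50f SURVIVES conjecture-grade, census 6/6 thin; `1 ≤ v₂ t` + Tam odd =
«Ш(W)[2] ≠ 0» under BSD₂. -ty: file P50a/P50b/P50c′ (NOT P50c) as theorem targets, P50d–f @[conjecture].»
REF2 v42 §1 = D-imc-50-R2 (refuter-bsd-f1-sign2-ref2 g42, `HOME/REF2-PLACEMENT-v42.md` 7533c70ad4d24b7e, INBOX 2026-08-28T23:06:00Z): (1) (U) at a₂ = 0: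
NOT IN PRINT — a₂ ≠ 0 is load-bearing in KO 2006 ONLY via Prop 1.3 (θ′ unit) ⇒ Lemma 2.3 (2), the index count of Thm 0.1; Lemma 2.2 / Lemma 2.3 (1) /
§2.2 Kato-at-2 / control are a₂-FREE as printed but ASSERTED only under a₂ = ±2; Kurihara 2002 is p odd throughout; Pollack 2005 Thm 1.1/Rem 1.2 «false at
p = 2, X₀(19)»; [cite: KuriharaOtsuki2006, Rem. 0.2 (3)] (27a1) shows (θ_n, νθ_{n−1}) can have infinite index at a₂ = 0 ⇒ the class restriction v₂N₃ = 5 is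
load-bearing; (2) §10.93 (C)(iii)/P50c′: VARIANT / new-in-detail of [cite: DengLi2026, Prop. 4.8, App. A] (n = 3 exceptional because λ(ξ_ℚ3) = 5 ≥ 4; one CM
curve 243 + twists, mod-4 Hecke congruences); the class-wide trichotomy / odd-level law is not in print; (3) P50d: NEW-COMBINATION, conjecture-grade,
beyond-print-ELIGIBLE as a statement (KO Thm 0.1 lever × Deng–Li a₂ = 0 valuations; no print gives finite-layer module structure or Ш-exponents at a₂ = 0,
p = 2; Deng–Li Thm 1.3 = rank 1 per layer + Ш(ℚ_∞)(2) infinite, CM-bound); (4) P50e: a₂ = ±2 = unstated corollary of KO «Sel₀(E/ℚ_n) = 0 ∀ n» at n = 1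
(theorem-grade), a₂ = 0 same paragraph verbatim but unasserted; cleaner frame = one-prime Poitou–Tate DICHOTOMY at T = {2} ([cite: MazurRubin2010, Lemma 3.2];
Kramer 1981; tree norm-index table); (5) P50f: NOT IN PRINT, VARIANT of -desc §27 «Ш[2] in the door» with the door at 2; falsifier upgrade to -data
(record (rk₂Sel₂(E), rk₂Sel₂(E^{(2)})) on the 753 rows; keep Tam-even rows out).  P50a = Pollack 2005 Lemma 5.2 / Prop 5.3 level exact sequence
at p = 2, corank 1 ([cite: Pollack2005, Lemma 5.2, Prop. 5.3]; REF2 v41 §1.4/§1.7).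
PARTITION: none moved; beyond-print theorem: no (P50a/P50b/P50c′ words-certified algebra targets, frontier-ledger entries; P50d–f conjecture-grade); BSD not
proved; no item closed; bears_on: stmt-BirchSwinnertonDyer-23715 (supersingular-at-2 third of the cell).

## The sketch's own summary (verbatim)

# Cell `bsd-f1-sign2` — IMC lens (seat `-imc`) g14, MEMO-imc §10.93 / D-imc-50 (SKETCH — statements only, for `-ty` / `-ref1`):
# the LEVEL EXACT SEQUENCE of the Kurihara pair at `p = 2` and what it buys —
# `KuriharaPairTorsionRecursion` (P50a, theorem-grade algebra, every `a`), `MazurTateLevelNormValuationRecursionAtTwo`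
# (P50b, theorem-grade algebra, `a` even), `MazurTateLevelNormJacobsthalLawAtTwo` (P50c, theorem-grade algebra: the whole
# D-imc-49 census table explained), `KuriharaOtsukiMinimalClassAtTwo` (P50d, conjecture-grade = KO 2006 Thm 0.1 EXTENDED to
# `a₂ = 0` on the class `v₂(N₃) = 5`), `TwistByTwoPointNotTwoDivisibleAtTwo` (P50e = the cheapest falsifier «P50-loc»,
# in-print-assembly for `a₂ = ±2`, conjecture-grade for `a₂ = 0`), `TwistByTwoPointTwoDivisibleAtTwoOffUnit` (P50f, the mirror law off the
# unit locus that the P50-loc run exposed; conjecture-grade).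

Notation (as g13 `SketchG13KPI.lean` b7efce60df678e30, whose three carriers are re-declared VERBATIM below because they are
not yet in the tree): `X = T = γ − 1`; `R_n := ℤ[X]/((1+X)^{2^n} − 1)`; `ν_n := 1 + (1+X)^{2^{n−1}} = Φ_{2^n}(1+X)`;
`ψ_n : R_n → O_n := ℤ[ζ_{2^n}]`, `X ↦ ζ_{2^n} − 1 =: π_n` (`e = 2^{n−1}`); for a sequence `θ : ℕ → ℤ[X]` the PAIR MODULE
`M_n(θ) := R_n/(θ_n, ν_n θ_{n−1}) = ℤ[X] ⧸ kuriharaPairIdeal (θ n) (θ (n−1)) n` and the LEVEL NORM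
`N_n := mtLevelNorm θ_n n = Res_X(Φ_{2^n}(1+X), θ_n) = N_{ℚ(ζ_{2^n})/ℚ}(ψ_n θ_n)`, `v_n := v₂(N_n) = v_{π_n}(ψ_n θ_n)`.
THREE-TERM RELATION at level `m ≥ 2`: `(1+X)^{2^{m−1}} − 1 ∣ θ_m − a·θ_{m−1} + ν_{m−1}·θ_{m−2}` (Mazur–Tate; `a = a₂(E)`;
at `p = 2` supersingular `a ∈ {0, ±2}`). `J_n` = the tree's `jacobsthal n` (`0,1,1,3,5,11,21,43,…`; `J_n = q_n` of KO 2006 for `n ≥ 2`).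

WORDS-PROOFS (MEMO-imc §10.93 (A)–(C)); nothing is asserted here, no `sorry`, no instance, no notation; every candidate is tagged
`@[conjecture]` (= unproved in the tree) — «THEOREM-grade» below is the seat's assessment that a words-proof exists (for `-ref1` to certify):
* (A) LEVEL EXACT SEQUENCE. If the level-`n` relation holds (any `a ∈ ℤ`) and `N_n ≠ 0`, then `x ↦ ν_n x` induces an INJECTIVE
  `R_n`-linear map `M_{n−1} → M_n` with cokernel `O_n/(ψ_n θ_n)` (order `|N_n|`): `Ann_{R_n}(ν_n) = ((1+X)^{2^{n−1}}−1) = ker(R_n → R_{n−1})`,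
  `ker ψ_n = ν_n R_n`, `(I_n : ν_n) = (θ_n, θ_{n−1}) + Ann(ν_n)` and its image in `R_{n−1}` is `(a θ_{n−1} − ν_{n−1}θ_{n−2}, θ_{n−1}) = I_{n−1}`.
  The free quotients of `M_{n−1}` and `M_n` are the SAME lattice (the image of `ℤ[X]` in `⊕_{m ∈ Z} O_m`, `Z` = common zero levels `< n`)
  and the induced map is `×2`, so the snake lemma gives P50a: `rank M_n = rank M_{n−1}` and `#tors M_n · 2^{rank} = #tors M_{n−1} · |N_n|`.
* (B) VALUATION RECURSION (`a` even). `ψ_n((1+X)^{2^{n−1}}−1) = −2` and `ψ_n(ν_{n−1}) = 1 + ζ_4` has `v_π = 2^{n−2}`, so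
  `ψ_n θ_n ≡ −(1+ζ_4)·θ_{n−2}(π_n) (mod 2 O_n)`; if `θ_{n−2}` (canonical representative, degree `< 2^{n−2}`) has its first ODD
  coefficient in degree `λ` then `v_π(θ_{n−2}(π_n)) = λ < 2^{n−2}` and P50b: `v₂(N_n) = 2^{n−2} + λ` (`N_n ≠ 0` automatically).
  A level `n` with `θ_{n−2} ∈ 2ℤ[X]` («`μ ≥ 1`») is FREE: `v_n ≥ 2^{n−1}` is not determined by lower data.
* (C) JACOBSTHAL LAW. With `θ_0 = d` odd and `θ_1 = c·(X+2)` (the level-`1` value `L(E,χ₈,1)` vanishes for every curve of the cell: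
  `N ≡ ±3 (8)`, KO Prop. 1.1): even levels are rigid, `v_{2k} = J_{2k}` (`λ(θ_{2k}) = J_{2k}` by induction `θ_{2k} ≡ X^{2^{2k−2}} θ_{2k−2}`);
  `c` odd (`a₂ = ±2`, KO: `c = ∓L/Ω`, `3L/Ω`) ⇒ `v_n = J_n` for every `n` (KO Prop. 1.3 recovered by algebra); `v₂(c) = 1` (`a₂ = 0`,
  `c = −2L/Ω`, KO p. 562 / Rem. 0.2 (3)) ⇒ level 3 is free and `v_3 ≤ 6 ⇒ v_{2k+1} = J_{2k+1} + (v_3 − 3)`, `(v_3 ≥ 8 ∨ N_3 = 0) ⇒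
  v_{2k+1} = J_{2k+1} + 4` (`k ≥ 2`), `v_3 = 7 ⟺ θ_3 ∈ 2R_3` (then level 5 is free, and so on). With the parity law L2 (g13 P49a⁺,
  `v_n` odd) the level-3 menu is `{5} ∪ {7} ∪ {9, 11, …} ∪ {∞}`. CENSUS (D-imc-49 j318021, 961 curves, `n ≤ 6`): even levels
  `(v_2,v_4,v_6) = (1,5,21)` on 626/626 basic curves; `a₂ = ±2`: `v_n = J_n` 321/321; `a₂ = 0` (305): `v_3 = 5 ⇒ v_5 = 13` 138/138,
  `v_3 ∈ {9,11,15,∞} ⇒ v_5 = 15` 79/79, `v_3 = 7 ⇒ v_5 ∈ {17,…,27}` free 88/88 — 0 exceptions.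
* (D) ARITHMETIC (conjecture-grade, MEMO-imc §10.93 (D)–(G)): KO 2006 §2.2 run verbatim at `a₂ = 0` («(U)»: `Sel(E/ℚ_n)^∨` is a cyclic
  `ℤ₂ ⊗ R_n/(θ_n, νθ_{n−1})`-module) + (A) give `#Ш(E/ℚ_n)[2^∞]/div ≤ 2^{I_n}`, `I_n = Σ_{m=2}^n (v_m − 1)`; the tree's IN-PRINT step norm
  index `SupersingularStepNormIndexAtTwo` (`= 2^{J_n}`, Kramer–Tunnell) + the exact Poitou–Tate cokernel formula + ODD-LEVEL NORM
  MEMBERSHIP of the `χ₈`-line (D-imc-47 Honda structure: `x_− = d_1 − 2ε ∈ Tr_{n/n−1} Ê(𝔪_n)` iff `n` odd) + Cassels–Tate squareness give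
  `≥ 2^{Σ(J_m − 1 + 2[m odd ≥ 3])}`; the two bounds MEET iff `v_3 = 5` — P50d. The `n = 2` step of the same chain is P50e.
-/

open scoped Classical MatrixGroups ModularForm NumberField Pointwise

open CongruenceSubgroup Polynomial WeierstrassCurve Literature.NumberTheory.EllipticCurves Literature.Barriers.BirchSwinnertonDyer
  Literature.NumberTheory.EllipticCurves.ModularForms
  Literature.NumberTheory.EllipticCurves.Rank1Residual ZpExtension

namespace Summit.BirchSwinnertonDyer.Rank1Residual.F1Sign2

/- REBASED (g14, 2026-08-28T22:40Z) on the tree row `F1Sign2/IntegralKuriharaPairAtTwo.lean` (p672838, port of g13's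
   `SketchG13KPI.lean`): the carriers `mtLevelNorm` (`N_m(P) = Res_X(Φ_{2^m}(1+X), P)`) and `kuriharaPairIdeal`
   (`((1+X)^{2^n} − 1, P, Q·ν_n)`) are now CITED from the tree, not redefined here. -/

/-- `#tors M_n(θ)` — the order of the torsion subgroup of the pair module `ℤ[X] ⧸ kuriharaPairIdeal (θ n) (θ (n−1)) n`
(a finitely generated abelian group; `Nat.card` of a finite group). -/
noncomputable def kuriharaPairTorsionCard (θ : ℕ → ℤ[X]) (n : ℕ) : ℕ :=
  Nat.card ↥(Submodule.torsion ℤ (ℤ[X] ⧸ kuriharaPairIdeal (θ n) (θ (n - 1)) n))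

/-- `rank M_n(θ)` — the `ℤ`-rank (`Module.finrank ℤ`) of the pair module. -/
noncomputable def kuriharaPairRank (θ : ℕ → ℤ[X]) (n : ℕ) : ℕ :=
  Module.finrank ℤ (ℤ[X] ⧸ kuriharaPairIdeal (θ n) (θ (n - 1)) n)

/-- The Mazur–Tate three-term relation at level `m ≥ 2` for a sequence `θ : ℕ → ℤ[X]` and trace `a`:
`(1+X)^{2^{m−1}} − 1 ∣ θ_m − a θ_{m−1} + (1 + (1+X)^{2^{m−2}}) θ_{m−2}`. -/
def MTThreeTermAt (a : ℤ) (θ : ℕ → ℤ[X]) (m : ℕ) : Prop :=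
  (((X : ℤ[X]) + 1) ^ (2 ^ (m - 1)) - 1) ∣ (θ m - C a * θ (m - 1) + (1 + ((X : ℤ[X]) + 1) ^ (2 ^ (m - 2))) * θ (m - 2))

/-- **P50a `KuriharaPairTorsionRecursion`** — candidate, THEOREM-grade (pure commutative algebra; MEMO-imc §10.93 (A), the level exact
sequence `0 → M_{n−1} →(×ν_n) M_n → O_n/(ψ_n θ_n) → 0`). For EVERY `a ∈ ℤ`, every sequence `θ : ℕ → ℤ[X]` satisfying the three-term
relation at level `n ≥ 2`, and `N_n ≠ 0`: the pair modules `M_n`, `M_{n−1}` have the same `ℤ`-rank `r` and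
`#tors M_n · 2^r = #tors M_{n−1} · |N_n|`. Consequences: g13's P49c♭ `KuriharaPairIndexLawFormal` (induction, base `#tors M_1 = gcd(c, d)`
for `θ_0 = d`, `θ_1 = c(X+2)`), KO 2006 Lemma 2.3 (2) with EQUALITY, and the index law with corank offset observed in D-imc-49 (`−r` per level).
REF1 §147: THEOREM-GRADE — words-proof (A) CERTIFIED step by step (Ann_{R_n}(ν_n) = ω_{n−1}R_n, ker ψ_n = (ν_n), Z_n = Z_{n−1}, index 2^r; independent exact
engine 18/18 incl. ODD `a` and generic lower levels); filed as a plain `def` (frontier-ledger words-theorem; the sketch had `@[conjecture]`).  REF2 v41 §1.4 /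
v42: = Pollack 2005 level exact sequence [cite: Pollack2005, Lemma 5.2, Prop. 5.3] transposed to p = 2, corank 1.
[cite: KuriharaOtsuki2006, Lemma 2.3 (2), §2.2 (the sequence before Lemma 2.3)] [cite: Kurihara2002, Lemma 7.1 (1), Thm. 7.4 (odd p)] -/
def KuriharaPairTorsionRecursion : Prop :=
  ∀ (a : ℤ) (θ : ℕ → ℤ[X]) (n : ℕ), 2 ≤ n → MTThreeTermAt a θ n →
    mtLevelNorm ((θ n).map (Int.castRingHom ℚ)) n ≠ 0 →
      kuriharaPairRank θ n = kuriharaPairRank θ (n - 1) ∧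
        (kuriharaPairTorsionCard θ n : ℚ) * 2 ^ kuriharaPairRank θ n =
          kuriharaPairTorsionCard θ (n - 1) * |mtLevelNorm ((θ n).map (Int.castRingHom ℚ)) n|

/-- **P50b `MazurTateLevelNormValuationRecursionAtTwo`** — candidate, THEOREM-grade (pure algebra; MEMO-imc §10.93 (B)). For `a` EVEN, the
three-term relation at level `n ≥ 2`, `θ_{n−2}` of degree `< 2^{n−2}` (canonical representative; for `n = 2` a constant) whose coefficients in
degrees `< lam` are even and whose coefficient in degree `lam < 2^{n−2}` is odd («`μ(θ_{n−2}) = 0`, `λ(θ_{n−2}) = lam`»): `N_n ≠ 0` and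
`v₂(N_n) = 2^{n−2} + lam`. (Proof: `ψ_n θ_n ≡ −(1 + ζ_4) θ_{n−2}(π_n) (mod 2)`, valuations `2^{n−2} + lam < 2^{n−1} = v_π(2)`.)
For `a = ±2` it reproduces `v₂(N_n) = q_n` from `λ(θ_{n−2}) = q_{n−2}` (KO Prop. 1.3); the mechanism is Kurihara's / Pollack's at odd `p`.
REF1 §147: THEOREM-GRADE, words-proof (B) CERTIFIED; the binder `(θ (n - 2)).natDegree < 2 ^ (n - 2)` is IDLE (158/158 + 8/8 with it violated); `Even a` and
`lam < 2 ^ (n - 2)` load-bearing; filed as a plain `def` (frontier-ledger words-theorem; the sketch had `@[conjecture]`).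
[cite: KuriharaOtsuki2006, Prop. 1.3, §1.2 (iii)] [cite: Kurihara2002, §7] [cite: Pollack2003, Thm. 5.6, §6] -/
def MazurTateLevelNormValuationRecursionAtTwo : Prop :=
  ∀ (a : ℤ) (θ : ℕ → ℤ[X]) (n lam : ℕ), 2 ≤ n → Even a → MTThreeTermAt a θ n →
    (θ (n - 2)).natDegree < 2 ^ (n - 2) → lam < 2 ^ (n - 2) →
    (∀ i : ℕ, i < lam → (2 : ℤ) ∣ (θ (n - 2)).coeff i) → ¬ (2 : ℤ) ∣ (θ (n - 2)).coeff lam →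
      mtLevelNorm ((θ n).map (Int.castRingHom ℚ)) n ≠ 0 ∧
        padicValRat 2 (mtLevelNorm ((θ n).map (Int.castRingHom ℚ)) n) = (2 ^ (n - 2) + lam : ℕ)

/-- **P50c′ `MazurTateLevelNormJacobsthalLawAtTwoR`** — REF1 §147 REPAIR of -imc g14's P50c `MazurTateLevelNormJacobsthalLawAtTwo` (NOT FILED — KILLED AS
TYPED, refuted-misstated), typed VERBATIM from REF1 `Probe147.lean` de756897465eecb2; THEOREM-GRADE (pure algebra; MEMO-imc §10.93 (C); the explanation of the
D-imc-49 census).  For `a` even, `θ_0 = d` with `d` odd, `θ_1 = c·(X + 2)`, canonical representatives (`deg θ_m < 2^m`) and the three-term relations at all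
levels `2 ≤ m ≤ n`: (i) EVEN LEVELS ARE RIGID: `n` even ⇒ `v₂(N_n) = J_n`; (ii) `c` odd (the `a₂ = ±2` basic case) ⇒ `v₂(N_n) = J_n` for every `n ≥ 2`
(KO Prop. 1.3); (iii) — RESTRICTED TO `a = 0` (the memo's own proof assumption in §10.93 (C)(iii) «With a = 0 the relation at m = 3 reads θ₃ = −ν₂θ₁ + ω₂q»,
and the only arithmetic case: `v₂(c) = 1 ⟺ a₂ = 0` on the basic locus) — `v₂(c) = 1`, `n` odd, `n ≥ 5`: `N_3 ≠ 0 ∧ v₂(N_3) ≤ 6 ⇒ v₂(N_n) = J_n + v₂(N_3) − 3`,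
and `(N_3 = 0 ∨ 8 ≤ v₂(N_3)) ⇒ v₂(N_n) = J_n + 4`.  REF1 §147: as typed with `Even a` only, (iii) is FALSE for `a ≡ 2 (mod 4)` — the term `a·θ₂(π₃)` has
`π₃`-valuation `4·v₂(a) + 1 = 5` and pollutes the level-3 trichotomy; explicit tower `a = 2, d = 1, c = 2, θ₂ = 3X + 6, θ₃ = 2θ₂ − ν₂θ₁ + ω₂X³ =
X⁷+4X⁶+6X⁵+4X⁴−2X³−8X²−6X+4, θ₄ = 2θ₃ − ν₃θ₂, θ₅ = 2θ₄ − ν₄θ₃` (canonical degrees 0,1,1,7,7,15; all relations exact): `N₃ = −4896·(±1)`, `v₂N₃ = 5 ≤ 6`, so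
(iii) demands `v₂N₅ = J₅ + 2 = 13`, but `v₂N₅ = 15` (`(μ,λ)(θ₃) = (0,7)`, P50b at n = 5); `4 ∣ a` would also do; the λ-form «`μ(θ₃) = 0 ∧ λ(θ₃) < 8 ⇒
v₂N_{2k+1} = J_{2k+1} + λ(θ₃) − 3`» holds for every even `a`.  (i)(ii) THEOREM-GRADE for every even `a` (engine 180/180, 80/80); (iii) at `a = 0`: 28/28 + 11/11.
CENSUS (BC5, -imc): D-imc-49 table `D49-CELLS.tsv` dfb0181626c8dd55 — (i) 626/626 × `n ∈ {2,4,6}`; (ii) 321/321 × `n ≤ 6`; (iii) 138/138 (`v_3 = 5 ⇒ v_5 = 13`)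
and 79/79 (`v_3 ∈ {9,11,15,∞} ⇒ v_5 = 15`); the remaining 88 (`v_3 = 7`, free level 5) are outside (iii). `J_n` = `jacobsthal n`.  Filed as a plain `def`
(REF1: «file P50a/P50b/P50c′ as theorem targets»).  REF2 v42 §1 (2): VARIANT / new-in-detail of [cite: DengLi2026, Prop. 4.8, App. A]; class-wide trichotomy not in print.
[cite: KuriharaOtsuki2006, Prop. 1.3, Rem. 0.2 (3)] [cite: Pollack2003, Thm. 5.6] -/
def MazurTateLevelNormJacobsthalLawAtTwoR : Prop :=
  ∀ (a c d : ℤ) (θ : ℕ → ℤ[X]) (n : ℕ), 2 ≤ n → Even a → Odd d →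
    θ 0 = C d → θ 1 = C c * (X + 2) →
    (∀ m : ℕ, m ≤ n → (θ m).natDegree < 2 ^ m) →
    (∀ m : ℕ, 2 ≤ m → m ≤ n → MTThreeTermAt a θ m) →
      (Even n → padicValRat 2 (mtLevelNorm ((θ n).map (Int.castRingHom ℚ)) n) = (jacobsthal n : ℕ)) ∧
      (Odd c → padicValRat 2 (mtLevelNorm ((θ n).map (Int.castRingHom ℚ)) n) = (jacobsthal n : ℕ)) ∧
      (a = 0 → padicValInt 2 c = 1 → Odd n → 5 ≤ n →
        (mtLevelNorm ((θ 3).map (Int.castRingHom ℚ)) 3 ≠ 0 →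
          padicValRat 2 (mtLevelNorm ((θ 3).map (Int.castRingHom ℚ)) 3) ≤ 6 →
            padicValRat 2 (mtLevelNorm ((θ n).map (Int.castRingHom ℚ)) n) =
              (jacobsthal n : ℕ) + padicValRat 2 (mtLevelNorm ((θ 3).map (Int.castRingHom ℚ)) 3) - 3) ∧
        ((mtLevelNorm ((θ 3).map (Int.castRingHom ℚ)) 3 = 0 ∨
            8 ≤ padicValRat 2 (mtLevelNorm ((θ 3).map (Int.castRingHom ℚ)) 3)) →
          padicValRat 2 (mtLevelNorm ((θ n).map (Int.castRingHom ℚ)) n) = (jacobsthal n : ℕ) + 4))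

/-- The predicted valuation vector of the MINIMAL `a₂ = 0` class: `v_m = J_m + 2·[m odd ∧ 3 ≤ m]` (`1, 5, 5, 13, 21, 45, 85, …` for `m = 2, 3, …`);
written with `cond`/`Nat.ble` (no `Decidable` instance search under `open scoped Classical`, so `decide` reduces it). -/
def koMinimalClassVal (m : ℕ) : ℕ :=
  jacobsthal m + cond (Nat.ble 3 m && (m % 2 == 1)) 2 0

/-- Partial sums `Σ_{3 ≤ i ≤ j, i ≤ n} min(k, n+1−i)·(v_i − v_{i−1})` of `e(n, k) := k + Σ_{i=3}^{n} min(k, n+1−i)·(v_i − v_{i−1})` — the exponent of `#(ℚ₂/ℤ₂ ⊕ T_n^∨)[2^k]` for the predicted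
`T_n ≅ ⊕_{i=3}^{n} (ℤ/2^{n+1−i})^{v_i − v_{i−1}}` (KO's staircase with `v` for `q`): `n = 3`: `(ℤ/2)⁴`; `4`: `(ℤ/4)⁴`; `5`: `(ℤ/2)⁸ ⊕ (ℤ/8)⁴`;
`6`: `(ℤ/2)⁸ ⊕ (ℤ/4)⁸ ⊕ (ℤ/16)⁴`; `e(n,1) = v_n` (`dim_{𝔽₂} Sel₂(E/ℚ_n) = 5, 5, 13, 21` for `n = 3,4,5,6`; g6 D-imc-17 descents give
`s_3 = s_4 = 5` on this class). -/
def koMinimalClassStairSum (n k : ℕ) : ℕ → ℕ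
  | 0 => 0
  | i + 1 => koMinimalClassStairSum n k i +
      cond (Nat.ble 3 (i + 1) && Nat.ble (i + 1) n) (Nat.min k (n - i) * (koMinimalClassVal (i + 1) - koMinimalClassVal i)) 0

/-- `e(n, k) := k + Σ_{i=3}^{n} min(k, n+1−i)·(v_i − v_{i−1})` (see `koMinimalClassStairSum`, the partial sums over `i ≤ j`). -/
def koMinimalClassExponent (n k : ℕ) : ℕ :=
  k + koMinimalClassStairSum n k n

/-- **P50d `KuriharaOtsukiMinimalClassAtTwo`** — candidate, CONJECTURE-grade (theorem-candidate given KO §2.2 at `a₂ = 0`; MEMO-imc §10.93 (D)–(G)).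
For `W/ℚ` globally minimal with good reduction at `2`, `a₂(W) = 0`, `ord₂(L(W,1)/Ω_W) = 0`, `Tam(W)` odd (KO's hypotheses with `a₂ = 0`, the
case KO 2006 exclude: Rem. 0.2 (3) «the condition is not sufficient to determine (g(T))»), newform `f`, and the ONE EXTRA BIT
`v₂(N_3(θ_{ℚ_3})) = 5` in the period-free normalisation `v₂ N_3(mazurTateElement f 2 3) − 4·v₂(θ_0(0)) = 5` (equivalently `λ(g̃) = 2` for
Pollack's `g = (T+2) g̃`; 138 of the 305 basic `a₂ = 0` curves with `N < 10⁴`): for the cyclotomic `ℤ₂`-extension and every `n ≥ 1`, `k`,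
`#Sel_{2^∞}(W/ℚ_n)[2^k] = 2^{e(n,k)}`, i.e. `Sel(W/ℚ_n) ≅ ℚ₂/ℤ₂ ⊕ ⊕_{i=3}^n (ℤ/2^{n+1−i})^{v_i − v_{i−1}}`, `v_i = J_i + 2[i odd ≥ 3]`
(so `Sel(W/ℚ) `…`= ℚ₂/ℤ₂` for `n = 1, 2`, and if `Ш(W/ℚ(√2))[2^∞]` is finite: `rank W(ℚ_n) = 1`, `Ш(W/ℚ_n)[2^∞] ≅ (ℤ/2)⁴, (ℤ/4)⁴, (ℤ/2)⁸⊕(ℤ/8)⁴, …`).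
WHY (words): upper bound `2^{I_n}`, `I_n = Σ_{m ≤ n}(v_m − 1)`, from (U) + P50a; lower bound from KO's `h₁/h₂` chain with the EXACT cokernel
`#Coker(Sel_{n−1} → Sel_n^G) = 2^{J_n − 1 + b_n}`, `b_n = [loc₂ Sel(ℚ_{n−1},T₂) ⊆ Tr E(k_n)] = 1` at odd `n ≥ 3` (the `χ₈`-line is a trace at odd
levels, D-imc-47) and Cassels–Tate (`#Ш/div` square, `I_n` even); they meet iff `v_m = J_m + 2[m odd ≥ 3]` iff `v_3 = 5` (P50c (iii)).
CHEAPEST FALSIFIER: `dim_{𝔽₂} Sel₂(W/ℚ_n) = e(n,1) = v_n = 5, 5` for `n = 3, 4` (g6 descents: 5, 5 ✓ on the class; `13` predicted at `n = 5`) and P50e below.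
REF1 §147: SURVIVES conjecture-grade; bricks (D2)–(D6) CERTIFIED one by one; inputs that are NOT print/tree-theorems: (U) at a₂ = 0, L14-loc, D-imc-47 (B4)(ii);
R-147-i: no analytic-rank binder on the twist, so the row contains «corank Sel_{2^∞}(E^{(2)}/ℚ) = 1 for every class-(α) basic curve»; (-ty: «P50c (iii)» in the
text above = the tree's P50c′ `MazurTateLevelNormJacobsthalLawAtTwoR`, clause (iii) at `a = 0`).  REF2 v42 §1 (3): NEW-COMBINATION, conjecture-grade,
beyond-print-ELIGIBLE as a statement; prior art [cite: DengLi2026, Thm. 1.3] (CM conductor 243, v₂N₃ = 5 class).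
[cite: KuriharaOtsuki2006, Thm. 0.1, Rem. 0.2 (3), §2.2–2.3] [cite: Kurihara2002, Thm. 0.1] [cite: Pollack2003, Thm. 5.6] [cite: KimKurihara2021, Rem. 1.10] -/
@[conjecture] def KuriharaOtsukiMinimalClassAtTwo : Prop :=
  ∀ {N : ℕ} [NeZero N] (f : CuspForm (Gamma0 N) 2) (W : WeierstrassCurve ℚ) [W.IsElliptic] [W.IsGloballyMinimal],
    IsNewformOf W f → W.HasGoodReductionAtPrime 2 → W.frobeniusTrace 2 = 0 → UnitLValueAtTwo W → ¬ 2 ∣ W.tamagawaProduct →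
    (mazurTateElement f 2 0).coeff 0 ≠ 0 → mtLevelNorm (mazurTateElement f 2 3) 3 ≠ 0 →
    padicValRat 2 (mtLevelNorm (mazurTateElement f 2 3) 3) - 4 * padicValRat 2 ((mazurTateElement f 2 0).coeff 0) = 5 →
    ∀ (κ : ZpExtension ℚ 2), κ.IsCyclotomic → ∀ n k : ℕ, 1 ≤ n →
      Nat.card {x : ↥(W.selmerLayer κ n) // (2 ^ k : ℕ) • x = 0} = 2 ^ koMinimalClassExponent n k

/-- **P50e `TwistByTwoPointNotTwoDivisibleAtTwo`** («P50-loc») — candidate; IN-PRINT ASSEMBLY for `a₂ = ±2` (KO 2006 Thm. 0.1 (2) at `n = 2`: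
`Sel(E/ℚ_2) ≅ ℚ₂/ℤ₂` ⇒ `Coker(Sel(ℚ_1) → Sel(ℚ_2)^G) = 0` ⇒ by the exact Poitou–Tate cokernel formula and Tate–Nakayama the localisation of
`Sel(E/ℚ_1, T₂) = E(ℚ(√2)) ⊗ ℤ₂ = E^{(2)}(ℚ) ⊗ ℤ₂` is NOT a trace from `E(ℚ_{2,2})`, in particular not in `2E(ℚ_{2,1})`), CONJECTURE-grade for
`a₂ = 0` (the same step run on (U)). Statement: `W/ℚ` globally minimal, good reduction at `2`, `2 ∣ a₂`, `ord₂(L(W,1)/Ω) = 0`, `Tam(W)` odd; `W'`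
any model of the quadratic twist by `2` (`E^{(2)} = E ⊗ χ₈`, the curve whose Mordell–Weil group is the `χ₈`-part of `E(ℚ_1)`, `ℚ_1 = ℚ(√2)`) of
analytic rank `1`: SOME rational point of `W'` is not `2`-divisible in `W'(ℚ₂)` (equivalently, `W'(ℚ) → W'(ℚ₂)/2` is onto `ℤ/2`; equivalently the
generator has `2`-adically integral `x`-coordinate on the `2`-minimal model, `W'(ℚ₂) ≅ ℤ₂` being pro-cyclic). A naive model predicts failure for
about half of all curves. CENSUS (BC5 witness, kit `bsd-frontier-data` j318734 pilot + j318779 full run, Heegner-point generators, two tests —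
`2`-adic roots of the halving quartic and `v₂(x)`): see MEMO-imc §10.93 (H).
REF1 §147: SURVIVES — a₂ = ±2 in-print assembly CERTIFIED brick by brick, a₂ = 0 conjecture; one typed row covers both ⇒ conjecture-class (a `frobeniusTrace 2 ≠ 0`
twin would be theorem-grade).  REF2 v42 §1 (4): a₂ = ±2 = unstated corollary of KO «Sel₀(E/ℚ_n) = 0 ∀ n» at n = 1; cleaner frame = one-prime Poitou–Tate
dichotomy at T = {2} ([cite: MazurRubin2010, Lemma 3.2]; Kramer 1981); nearest print on the divisibility side [cite: KrizLi2019, Thm. 1.12] (2 split in K).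
[cite: KuriharaOtsuki2006, Thm. 0.1 (2), Prop. 1.4, §2.3] [cite: Kramer1981, Prop. 4] [cite: GrossZagier1986, Thm. I.6.3] [cite: Kolyvagin1990, Thm. A] -/
@[conjecture] def TwistByTwoPointNotTwoDivisibleAtTwo : Prop :=
  ∀ (W : WeierstrassCurve ℚ) [W.IsElliptic] [W.IsGloballyMinimal],
    W.HasGoodReductionAtPrime 2 → (2 : ℤ) ∣ W.frobeniusTrace 2 → UnitLValueAtTwo W → ¬ 2 ∣ W.tamagawaProduct →
    ∀ (W' : WeierstrassCurve ℚ) [W'.IsElliptic],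
      (∃ C : VariableChange ℚ, C • W.quadraticTwist 2 = W') → W'.analyticRank = 1 →
      ∃ (x y : ℚ) (h : (W'.baseChange ℚ_[2]).toAffine.Nonsingular (algebraMap ℚ ℚ_[2] x) (algebraMap ℚ ℚ_[2] y)),
        W'.toAffine.Nonsingular x y ∧
          ¬ ∃ Q : (W'.baseChange ℚ_[2]).toAffine.Point,
            Q + Q = WeierstrassCurve.Affine.Point.some (algebraMap ℚ ℚ_[2] x) (algebraMap ℚ ℚ_[2] y) h

/-- **REFUTED AS TYPED — RECORDED NEGATIVE, DO NOT STAFF** (-imc g14, MEMO-imc §10.93-add2 memo 038e536ee933f398, CANDIDATES-delta IMC v4.2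
2026-08-28T23:39:51Z; kit j319563 `p50ext-full`, 2 153 curves, two engines): the law below fails on 5 of 401 Tam-odd, `Ш_an(W)`-even rows — witnesses
`58675c1` = [0,0,1,−6875,219531], `74331a1`, `74331b1`, `79325c1`, `96971c1` (Tam 1,1,3,5,1; `Ш_an(W) = 4`; generator of `E^{(2)}(ℚ)` with `v₂(x) = 0,0,0,3,1`,
both engines), i.e. `¬ TwistByTwoPointTwoDivisibleAtTwoOffUnit` holds numerically (a kernel refutation would need the 2-adic non-divisibility of one explicit
point; not attempted).  The tree is append-only: the declaration and its `@[conjecture]` tag stay as filed (p676729); it is SUPERSEDED by -imc's v3 laws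
P50f′ `TwistByTwoPointNotTwoDivisibleAtTwoOfHalfUnit` (`v₂(L/Ω) = 1` ⇒ some rational point of the rank-1 twist NOT 2-divisible in `W′(ℚ₂)`; 0/364) and
P50f″ `TwistByTwoPointTwoDivisibleAtTwoOfOddTwistSha` (`1 ≤ v₂(L/Ω)`, Tam odd, `#Sel₂(W′) = 2` ⇒ every rational point 2-divisible; 388/388), sketch
`SketchG14KPI.lean` v3 2494f823e53d84ea — to be APPENDED here by -ty after REF1 grades them (D-imc-50-R1 add2).  ORIGINAL DOCSTRING (as filed):
**P50f `TwistByTwoPointTwoDivisibleAtTwoOffUnit`** («P50-loc⁻», the mirror law the full run exposed) — candidate, CONJECTURE-grade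
(census 6/6 Tam-odd + 2/2 Tam-even curves with `Ш_an(W)` even, against 0/630 on the unit locus; MEMO-imc §10.93 (H)): same setting as P50e but
OFF the unit locus with `Tam(W)` odd — `W/ℚ` globally minimal, good supersingular reduction at `2`, `L(W,1) ≠ 0` with `ord₂(L(W,1)/Ω_W) ≥ 1`
(⟺ `2 ∣ #Ш(W)_an`, torsion being odd), `Tam(W)` odd, `W'` a model of the twist by `2` of analytic rank `1`: EVERY rational point of `W'` is
`2`-divisible in `W'(ℚ₂)` (i.e. `v₂(x(P)) < 0` on the `2`-minimal model, `W'(ℚ₂) ≅ ℤ₂` with `2W'(ℚ₂) = Ŵ'(2ℤ₂)`). WHY (words): with `Tam(W)` odd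
the exact cokernel `#Coker(Sel(W/ℚ_1) → Sel(W/ℚ_2)^G) = 2^{b_2}` can only be realised AT 2, and `μ(θ_{ℚ_0}) ≥ 1` frees level `2`
(`v₂(N_2) ≥ 2`, BSD₂ growth `I_2 > I_1`); on the unit locus the same formula forces `b_2 = 0` (P50e). Data: kit j318779, rows `1325d1, 1613b1,
1717a1, 3509b1, 3883b1, 571a1` (Tam odd, `Ш_an = 4`) and `1309a1, 1701i1` (Tam even, `Ш_an = 16, 4`) divisible; `ord₂(L/Ω) = 1` (Tam ≡ 2 (4)): 0/98.
REF1 §147: SURVIVES conjecture-grade, census 6/6 thin; `1 ≤ v₂ t` + Tam odd = «Ш(W)[2] ≠ 0» under BSD₂.  REF2 v42 §1 (5): NOT IN PRINT, VARIANT of -desc §27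
«Ш[2] in the door» with the door at 2; falsifier upgrade to -data (record (rk₂Sel₂(E), rk₂Sel₂(E^{(2)})); keep Tam-even rows out).
[cite: KuriharaOtsuki2006, §2.3] [cite: Kramer1981, Prop. 4] [cite: GrossZagier1986, Thm. I.6.3] [cite: Kolyvagin1990, Thm. A] -/
@[conjecture] def TwistByTwoPointTwoDivisibleAtTwoOffUnit : Prop :=
  ∀ (W : WeierstrassCurve ℚ) [W.IsElliptic] [W.IsGloballyMinimal],
    W.HasGoodReductionAtPrime 2 → (2 : ℤ) ∣ W.frobeniusTrace 2 →
    (∃ t : ℚ, W.entireLFunction 1 / (W.realPeriodRat : ℂ) = (t : ℂ) ∧ t ≠ 0 ∧ 1 ≤ padicValRat 2 t) → ¬ 2 ∣ W.tamagawaProduct →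
    ∀ (W' : WeierstrassCurve ℚ) [W'.IsElliptic],
      (∃ C : VariableChange ℚ, C • W.quadraticTwist 2 = W') → W'.analyticRank = 1 →
      ∀ (x y : ℚ) (h : (W'.baseChange ℚ_[2]).toAffine.Nonsingular (algebraMap ℚ ℚ_[2] x) (algebraMap ℚ ℚ_[2] y)),
        W'.toAffine.Nonsingular x y →
          ∃ Q : (W'.baseChange ℚ_[2]).toAffine.Point,
            Q + Q = WeierstrassCurve.Affine.Point.some (algebraMap ℚ ℚ_[2] x) (algebraMap ℚ ℚ_[2] y) h

/-- Sanity (kernel): the predicted valuation vector starts `v_2, …, v_7 = 1, 5, 5, 13, 21, 45`. -/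
theorem koMinimalClassVal_values :
    [koMinimalClassVal 2, koMinimalClassVal 3, koMinimalClassVal 4, koMinimalClassVal 5, koMinimalClassVal 6, koMinimalClassVal 7] =
      [1, 5, 5, 13, 21, 45] := by
  decide

/-- Sanity (kernel): `e(n,1) = v_n = 5, 5, 13, 21` for `n = 3,4,5,6` (the `Sel₂`-dimension equals `v₂(N_n)` on the class) and the
staircase sizes `e(3,·) = (5,6,7)`, `e(4,2) = 10`, `e(5,3) = 23`, `e(6,4) = 44 = 4 + I_6`, `I_6 = Σ(v_m − 1) = 0+4+4+12+20 = 40`. -/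
theorem koMinimalClassExponent_values :
    [koMinimalClassExponent 3 1, koMinimalClassExponent 4 1, koMinimalClassExponent 5 1, koMinimalClassExponent 6 1,
      koMinimalClassExponent 3 2, koMinimalClassExponent 3 3, koMinimalClassExponent 4 2, koMinimalClassExponent 5 3,
      koMinimalClassExponent 6 4] = [5, 5, 13, 21, 6, 7, 10, 23, 44] := by
  decide

/-! ### APPEND (pass 2, -ty g13): P50g — the KURIHARA–OTSUKI CYCLIC UPPER BOUND at 2 (-imc g14 MEMO-imc §10.93-add1 «(U)-reading», v2 sketch
`MEMO-imc-data/dimc50/lean/SketchG14KPI.lean` 5ae2e4516bd634b6; held until REF1 §148 (2026-08-28T23:21:49Z) audited §10.93-add1: SURVIVES AS TYPED, riders R-148-i/ii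
applied below — R-148-i as a separately named twin so that -imc's probed body stays verbatim).  Statement-only; BSD not proved; 23715 not closed. -/

/-- Carrier for P50g: the order of `M_n(θ) ⊗ ℤ/2^k`, `M_n(θ) = ℤ[X] ⧸ kuriharaPairIdeal (θ n) (θ (n−1)) n` (a finitely generated
`ℤ`-module, so the quotient by `2^k` is finite; `= 2^{k·rank} · #(tors ⊗ ℤ/2^k)`). -/
noncomputable def kuriharaPairModTwoPowCard (θ : ℕ → ℤ[X]) (n k : ℕ) : ℕ :=
  Nat.card ((ℤ[X] ⧸ kuriharaPairIdeal (θ n) (θ (n - 1)) n) ⧸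
    (2 ^ k : ℤ) • (⊤ : Submodule ℤ (ℤ[X] ⧸ kuriharaPairIdeal (θ n) (θ (n - 1)) n)))

/-- **P50g `KuriharaOtsukiCyclicUpperBoundAtTwo`** — candidate, THEOREM-CANDIDATE for EVERY `a₂ ∈ {0, ±2}` (MEMO-imc §10.93-add1
«(U)-READING»): KO 2006 Lemma 2.2 (`Sel(E/ℚ_n)^∨ ≅ H¹(k_n,T)/(E(k_n) ⊗ ℤ₂ + ⟨z_{ℚ_n}⟩)`, a CYCLIC `Λ_n`-module, from Kato's zeta elements,
`exp*(z_ℚ) = ω_E (1 − a₂/2 + 1/2) L(E,1)/Ω_E` with the Euler factor `(3 − a₂)/2 ∈ 2⁻¹ℤ₂^×` for all three values of `a₂`, and Rubin 1998 Prop. 5.2),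
Lemma 2.3 (1) (`θ_{ℚ_n} Sel^∨ = 0`, Kurihara's Dieudonné-module argument for general `a_p`) and Kurihara 2002 Lemma 7.1 (3) (then `ν θ_{ℚ_{n−1}}` kills too)
use `a₂ ≠ 0` NOWHERE — KO's hypothesis `a₂ = ±2` enters only Prop. 1.3 / Lemma 2.3 (2), the SIZE of `Λ′_n/I′_n`. Hence for `W/ℚ` globally minimal,
good supersingular at `2` (`2 ∣ a₂`), `ord₂(L(W,1)/Ω) = 0`, `Tam(W)` odd, and `θ` ANY odd rescaling of the Mazur–Tate elements (`θ_m = u·θ^{MT}_m`,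
`u ∈ ℚ` a `2`-adic unit, all `θ_m ∈ ℤ[X]`): `Sel_{2^∞}(W/ℚ_n)^∨` is a quotient of `ℤ₂ ⊗ M_n(θ)`, so `#Sel(W/ℚ_n)[2^k] ≤ #(M_n(θ) ⊗ ℤ/2^k)` for all
`n ≥ 1`, `k`. TIGHT on data: minimal class `n = 3, 4`, `k = 1`: `M_3 ≅ ℤ ⊕ (ℤ/2)⁴`, `M_4 ≅ ℤ ⊕ (ℤ/4)⁴` give `2⁵ = 2^{s_3} = 2^{s_4}` (g6/g13
descents `s_3 = s_4 = 5`); with P50a–c it yields `ord₂ #tors Sel(W/ℚ_n)^∨ ≤ I_n = Σ_{m ≤ n}(v_m − 1)` for every basic curve, and equality on the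
class `v₂(N_3) = 5` is P50d. CHEAPEST FALSIFIER: any basic curve and level with `dim Sel₂(W/ℚ_n) > rank M_n + dim (tors M_n)[2]`
(e.g. `s_3 ≥ 6` on classes (α), (γ), or `s_2 ≥ 2` anywhere).
REF1 §148 (refuter -ref1 g14, `HOME/REF1-AUDIT-v1.md` §148, `REF1-data/b148/lean/Probe148.lean` b446ede592c568e1 farm rc 0): **SURVIVES AS TYPED**;
(U)-reading (k1)–(k6) CERTIFIED a₂-FREE from the printed text (KO pp. 564–567: a₂ ≠ 0 is used ONLY in Prop. 1.3 / Lemma 2.3 (2), the valuation side;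
the cyclicity step KO leave implicit is certified a₂-free: cor `H¹(k_n,T)_{G_n} ⥲ H¹(ℚ₂,T) ≅ ℤ₂²`, `z_ℚ ∉ 2H¹ + H¹_f` because `v₂ exp*(z_ℚ) = −1`, so
`dim Q_n/𝔪Q_n ≤ 1`).  R-148-ii (docstring rider, REF1's wording): the «Rubin 1998 Prop. 5.2» input above is replaced by the two-line FORMAL-GROUP fact
«image(exp*_ω : H¹(ℚ₂,T) → ℚ₂·ω) = 2⁻¹ℤ₂·ω for EVERY `E/ℚ₂` with good supersingular reduction» — a₂-free by the Newton polygon of `[2]` (`E(k_n)[2] = 0`,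
`log Ê(2ℤ₂) = 2ℤ₂`, odd index `3 − a₂`), whatever Rubin's phrasing; CAVEATS inherited from KO Thm 0.1 itself (no new one): S1 — Kato Thm 12.4 (3) /
12.5 (4) are «p ≠ 2» (+ (12.5.2)) in print [Astérisque 295, pp. 106–107], used at 2 by KO's assertion (p. 564 l.29–31, cyclotomic ℤ₂-extension); S2 —
Kurihara 2002 Lemma 7.1/7.2 are printed for odd p («same method»; acq-14314).  GRADE SPLIT: (i) a₂ = ±2: = KO 2006 Thm 0.1 (1) + unit-ratio normalisation
⇒ EQUALITY for every k — KNOWN/in print; (ii) a₂ = 0, non-CM: THEOREM-CANDIDATE = KO pp. 564–567 run verbatim, «in-print-method modulo S1/S2»; (iii) a₂ = 0,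
CM (27a1, 243b1, 675c1, 675e1, 1323b1, 3267a1, 3267b1 in D17): conjecture-grade, ENGINE-LESS at 2 (Kato §15 = Rubin, Thm 15.2 (b) impossible at p = 2),
data-tight 7/7 — R-148-i recommends the binder `¬ W.HasCM` (typed below as the twin `KuriharaOtsukiCyclicUpperBoundAtTwoNonCM` + kernel glue; this
def keeps -imc's body VERBATIM and COVERS the CM sub-case (iii) as a conjecture).  k = 1 predictions `s = (·,1,1,5,5)` on EVERY basic a₂ = 0 curve:
D17 156/156 + 163/163 + CM 7/7, D16A 30/30 + 8/8 tight, 0 violations; cheapest open falsifier `s_4 ≥ 6` on a class-(7,1,3)/(≥ 9) curve.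
REF2 v42 §1/§6 (-ref2 g42, `REF2-PLACEMENT-v42.md`): (U) at a₂ = 0 NOT IN PRINT (beyond print AS A STATEMENT once proved; its proof is a transport of
printed pages, not new mechanism); a₂ = ±2 = [cite: KuriharaOtsuki2006, Thm. 0.1 (1)].  PARTITION none; beyond-print theorem: no; BSD not proved.
[cite: KuriharaOtsuki2006, Lemma 2.2, Lemma 2.3 (1), p. 564–567] [cite: Kurihara2002, Lemma 7.1, Lemma 7.2, Prop. 5.2] [cite: Rubin1998Durham, Prop. 5.2]
[cite: Kato2004, Thm. 12.5] -/
@[conjecture] def KuriharaOtsukiCyclicUpperBoundAtTwo : Prop :=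
  ∀ {N : ℕ} [NeZero N] (f : CuspForm (Gamma0 N) 2) (W : WeierstrassCurve ℚ) [W.IsElliptic] [W.IsGloballyMinimal],
    IsNewformOf W f → W.HasGoodReductionAtPrime 2 → (2 : ℤ) ∣ W.frobeniusTrace 2 → UnitLValueAtTwo W → ¬ 2 ∣ W.tamagawaProduct →
    ∀ (θ : ℕ → ℤ[X]) (u : ℚ), u ≠ 0 → padicValRat 2 u = 0 →
      (∀ m : ℕ, (θ m).map (Int.castRingHom ℚ) = C u * mazurTateElement f 2 m) →
      ∀ (κ : ZpExtension ℚ 2), κ.IsCyclotomic → ∀ n k : ℕ, 1 ≤ n →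
        Nat.card {x : ↥(W.selmerLayer κ n) // (2 ^ k : ℕ) • x = 0} ≤ kuriharaPairModTwoPowCard θ n k

/-- **P50g-nonCM `KuriharaOtsukiCyclicUpperBoundAtTwoNonCM` — REF1 §148 rider R-148-i (the typer's name for REF1's recommended body):** P50g with the
binder `¬ W.HasCM` inserted after `IsNewformOf W f` — the a₂ = ±2 (in print) ∪ a₂ = 0 non-CM (THEOREM-CANDIDATE, in-print-method modulo S1/S2) population,
i.e. P50g minus its engine-less CM sub-case (iii).  Body = -imc's v2 body 5ae2e4516bd634b6 with exactly that one binder added; `@[conjecture]` because the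
a₂ = 0 half is not a printed theorem (REF2 v42: NOT IN PRINT).  Kernel glue `kuriharaOtsukiCyclicUpperBoundAtTwoNonCM_of` below: P50g ⇒ P50g-nonCM.
[cite: KuriharaOtsuki2006, Lemma 2.2, Lemma 2.3 (1), p. 564–567] [cite: Kurihara2002, Lemma 7.1, Lemma 7.2] [cite: Kato2004, Thm. 12.5] -/
@[conjecture] def KuriharaOtsukiCyclicUpperBoundAtTwoNonCM : Prop :=
  ∀ {N : ℕ} [NeZero N] (f : CuspForm (Gamma0 N) 2) (W : WeierstrassCurve ℚ) [W.IsElliptic] [W.IsGloballyMinimal],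
    IsNewformOf W f → ¬ W.HasCM → W.HasGoodReductionAtPrime 2 → (2 : ℤ) ∣ W.frobeniusTrace 2 → UnitLValueAtTwo W → ¬ 2 ∣ W.tamagawaProduct →
    ∀ (θ : ℕ → ℤ[X]) (u : ℚ), u ≠ 0 → padicValRat 2 u = 0 →
      (∀ m : ℕ, (θ m).map (Int.castRingHom ℚ) = C u * mazurTateElement f 2 m) →
      ∀ (κ : ZpExtension ℚ 2), κ.IsCyclotomic → ∀ n k : ℕ, 1 ≤ n →
        Nat.card {x : ↥(W.selmerLayer κ n) // (2 ^ k : ℕ) • x = 0} ≤ kuriharaPairModTwoPowCard θ n k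

/-- KERNEL glue (REF1 §148 R-148-i): P50g ⇒ its non-CM restriction (drop one hypothesis). -/
theorem kuriharaOtsukiCyclicUpperBoundAtTwoNonCM_of (h : KuriharaOtsukiCyclicUpperBoundAtTwo) : KuriharaOtsukiCyclicUpperBoundAtTwoNonCM :=
  fun f W _ _ hf _ hgood hss hL htam θ u hu hv hθ κ hκ n k hn ↦ h f W hf hgood hss hL htam θ u hu hv hθ κ hκ n k hn

end Summit.BirchSwinnertonDyer.Rank1Residual.F1Sign2
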